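import Summits.BirchSwinnertonDyer.BirchSwinnertonDyer.Theorems.SignedLowerHalvesKobayashiLowerHalfLargeImageKuriharaRigidityThreeEngine
import Summits.BirchSwinnertonDyer.Rank1Residual.Supersingular.KobayashiMainConjectureX7FouquetWan
import HarnessLib

/-!
# Line `kurihara_rigidity` of crux `KobayashiLowerHalfLargeImage` (route `SignedLowerHalves`, item
# stmt-BirchSwinnertonDyer-19001) at `p = 3`: the residue of the Kurihara road at `3` CUT by the Fouquet–Wan
# locus — `stub_three` ⟸ {KKS@3 engine, Kurihara's conjecture at 3 on the good rows, FW Thm 5.1 ∘ Kobayashi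
# 7.4 (PRE binder) on the locus, the crux on what is left} (cell `bsd-ssimc`, seat `bsd-line-slh-p1` lead
# gen 2, cycle 2; `--supports` 19001, helper; closes nothing)

HONEST FRAMING: compositions BY NAME; every open input displayed; nothing booked; BSD is not proved.

WHAT. `…KuriharaRigidityThreeEngine.lean` (p614706) left, at `p = 3`, the honest residue `hR` = «the crux's
conclusion at the X7@3 ∧ ¬CM ∧ `a₃ = 0` ∧ Surj pairs OFF the good rows» (good rows = Kim–Kim–Sun's (Tam) first
clause ∧ `3 ∤ ∏ c_ℓ`). Independently, the route's birth line (planner g11; lev g5 `…LargeImageFWLocusAllRanks`,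
`X7.kobayashiLowerDivisibility_of_thm51_OPEN` of `Rank1Residual/Supersingular/KobayashiMainConjectureX7FouquetWan.lean`)
closes the crux at EVERY odd `p` — so at `3` too (flag A-KATO-3 of the W-lev-9 audit: FW's Kato input
[KLZ17] carries `p ≥ 5`) — on the FOUQUET–WAN LOCUS «∃ ℓ ≠ p prime, multiplicative, NON-split,
`p ∤ ord_ℓ(Δ_min)`» modulo the OPEN composite binder `FouquetWan2021_thm51_via_kobayashi74_OPEN` (Fouquet–Wan
arXiv:2107.13726 Thm 5.1, PRE ∘ Kobayashi Thm 7.4, PUB; derived from finer inputs by w2's p613756). The two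
side conditions are independent (KKS wants no non-split `q ≡ 2 (3)` and no split `q ≡ 1 (3)`; FW wants SOME
non-split `ℓ` with `3 ∤ ord_ℓ Δ`). This file intersects the residues: `stub_three` ⟸ {engine at 3 (KKS@3
binder + period@3), Kurihara's conjecture at 3 on the good rows, the FW binder on the locus, and the crux ONLY
at the X7@3 ∧ ¬CM ∧ Surj pairs that are OFF the good rows AND OFF the FW locus}; and the crux BY NAME likewise.

References: [KimKimSun2020] Thm 1.1; [FouquetWan2021] Thm 5.1 (PRE); [Kobayashi2003] Thm 7.4; [Kim2022StructureSelmer]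
Thm 1.11, Rem 6.2; [CastellaSano2026] Thm 1 (PRE); W-lev-9 audit (pub/bsd-ssimc/bsd-ssimc-lev/W-lev-9-FouquetWan-audit.md).
-/

set_option autoImplicit false

set_option linter.dupNamespace false

noncomputable section

open scoped Classical MatrixGroups ModularForm

open CongruenceSubgroup WeierstrassCurve Literature.NumberTheory.EllipticCurves
  Literature.NumberTheory.EllipticCurves.ModularForms
  Literature.NumberTheory.EllipticCurves.Rank1Residual
  Literature.NumberTheory.EllipticCurves.Rank1Residual.Typed
  Summit.BirchSwinnertonDyer.Rank1Residual.Supersingular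
  Summit.BirchSwinnertonDyer.Rank1Residual.X4

namespace Summit.BirchSwinnertonDyer.BirchSwinnertonDyer.Theorems.KuriharaRigidity

/-- **`stub_three` (registered statement, verbatim) with its residue cut by BOTH roads at `3`**: GRANTED the
KKS@3 binder (`hKKS`, flag `KKS20@3-MR-H4`), the `p = 3` period fact (`h3`) and the FW binder (`hFW`, PRE), and
the OPEN statements `hU` (Kurihara's conjecture at `3` on the rows X7@3 ∧ ¬CM ∧ `a₃ = 0` ∧ Surj ∧ (Tam)₁ ∧
`3 ∤ ∏ c_ℓ`) and `hR` (the crux's conclusion at the X7@3 ∧ ¬CM ∧ `a₃ = 0` ∧ Surj pairs that are NEITHER on a good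
row NOR on the Fouquet–Wan locus «∃ ℓ ≠ 3 prime, multiplicative, non-split, `3 ∤ ord_ℓ(Δ_min)`»). Proof: on the
locus `X7.kobayashiLowerDivisibility_of_thm51_OPEN`; off it `stub_three_of_kks_of_kuriharaUnit_of_offTam`.
CONDITIONAL; closes nothing. [cite: KimKimSun2020, Thm. 1.1] [claim: FouquetWan2021, status: under-review]
[cite: Kobayashi2003, Thm. 7.4 (p. 13)] -/
theorem stub_three_of_kks_of_fw51_OPEN_of_kuriharaUnit_of_residue
    (hKKS : KimKimSun2020_thm11_via_kobayashi74_three) (h3 : realPeriodRat_eq_unit_mul_plusPeriod_three)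
    (hFW : FouquetWan2021_thm51_via_kobayashi74_OPEN)
    (hU : ∀ (W : WeierstrassCurve ℚ) [W.IsElliptic] [W.IsGloballyMinimal] (p : ℕ) [Fact p.Prime],
      p = 3 → ClassX7 W p → ¬ W.HasCM → W.frobeniusTrace p = 0 → Surj W p → KimKimSun2020TamAt W p →
      ¬ p ∣ W.tamagawaProduct →
      ∀ [NeZero (W.conductorNorm ℤ)] (f : CuspForm (Gamma0 (W.conductorNorm ℤ)) 2),
        IsNewformOf W f → KuriharaUnitAt W p f)
    (hR : ∀ (W : WeierstrassCurve ℚ) [W.IsElliptic] [W.IsGloballyMinimal] (p : ℕ) [Fact p.Prime],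
      p = 3 → ClassX7 W p → ¬ W.HasCM → W.frobeniusTrace p = 0 → Surj W p →
      ¬ (KimKimSun2020TamAt W p ∧ ¬ p ∣ W.tamagawaProduct) →
      ¬ (∃ (ℓ : ℕ) (_ : Fact ℓ.Prime), ℓ ≠ p ∧ W.HasMultiplicativeReductionAtPrime ℓ ∧
          ¬ W.HasSplitMultiplicativeReductionAtPrime ℓ ∧ ¬ p ∣ padicValInt ℓ W.minimalDiscriminantInt) →
      ∃ ε : ℤˣ, KobayashiLowerDivisibility W p ε) :
    ∀ (W : WeierstrassCurve ℚ) [W.IsElliptic] [W.IsGloballyMinimal] (p : ℕ) [Fact p.Prime],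
      p = 3 → ClassX7 W p → ¬ W.HasCM → W.frobeniusTrace p = 0 → Surj W p →
      ∃ ε : ℤˣ, KobayashiLowerDivisibility W p ε :=
  stub_three_of_kks_of_kuriharaUnit_of_offTam hKKS h3 hU (fun W _ _ p _ hp3 hX hcm hap hs hT => by
    by_cases hloc : ∃ (ℓ : ℕ) (_ : Fact ℓ.Prime), ℓ ≠ p ∧ W.HasMultiplicativeReductionAtPrime ℓ ∧
        ¬ W.HasSplitMultiplicativeReductionAtPrime ℓ ∧ ¬ p ∣ padicValInt ℓ W.minimalDiscriminantInt
    · exact X7.kobayashiLowerDivisibility_of_thm51_OPEN W p hFW (by omega) hX hap hloc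
    · exact hR W p hp3 hX hcm hap hs hT hloc)

/-- **The crux BY NAME with its `p = 3` residue cut by both roads**: crux ⟸ binders {Kim 1.11 ∘ Ko 7.4 (PUB,
`hKK`), CS Thm 1 ∘ Ko 7.4 (PRE, `hCS`), CS §2 `≥` reading (PRE, `hCSge`), period at `p ≥ 5` (PUB, `h5`), KKS Thm 1.1
at 3 ∘ Ko 7.4 (flag `KKS20@3-MR-H4`, `hKKS`), period at 3 (PUB, `h3`), FW Thm 5.1 ∘ Ko 7.4 (PRE, `hFW`)} + OPEN
statements {`≤` half of Kim's Conj. 1.10 on X7 ∧ ¬CM ∧ Surj ∧ `p ≥ 5` (`hLe`), Kurihara's conjecture at `3` on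
the good rows (`hU`), the crux at the X7@3 pairs off the good rows and off the FW locus (`hR`)}. CONDITIONAL;
closes nothing; BSD is not proved by this. [cite: Kim2022StructureSelmer, Thm. 1.11]
[claim: CastellaSano2026, status: under-review] [claim: FouquetWan2021, status: under-review]
[cite: KimKimSun2020, Thm. 1.1] [cite: Kobayashi2003, Thm. 7.4 (p. 13)] -/
theorem kobayashiLowerHalfLargeImage_of_readings_of_kks_of_fw51_OPEN
    (hKK : Kim2026_thm111_via_kobayashi74) (hCS : CastellaSano2026_thm1_via_kobayashi74_OPEN)
    (hCSge : CastellaSano2026_sec2_tamagawaDefectGe_implicit_OPEN) (h5 : realPeriodRat_eq_unit_mul_plusPeriod)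
    (hKKS : KimKimSun2020_thm11_via_kobayashi74_three) (h3 : realPeriodRat_eq_unit_mul_plusPeriod_three)
    (hFW : FouquetWan2021_thm51_via_kobayashi74_OPEN)
    (hLe : ∀ (W : WeierstrassCurve ℚ) [W.IsElliptic] [W.IsGloballyMinimal] (p : ℕ) [Fact p.Prime],
      5 ≤ p → ClassX7 W p → ¬ W.HasCM → W.frobeniusTrace p = 0 → Surj W p →
      ∀ [NeZero (W.conductorNorm ℤ)] (f : CuspForm (Gamma0 (W.conductorNorm ℤ)) 2),
        IsNewformOf W f → KimTamagawaDefectLeAt W p f)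
    (hU : ∀ (W : WeierstrassCurve ℚ) [W.IsElliptic] [W.IsGloballyMinimal] (p : ℕ) [Fact p.Prime],
      p = 3 → ClassX7 W p → ¬ W.HasCM → W.frobeniusTrace p = 0 → Surj W p → KimKimSun2020TamAt W p →
      ¬ p ∣ W.tamagawaProduct →
      ∀ [NeZero (W.conductorNorm ℤ)] (f : CuspForm (Gamma0 (W.conductorNorm ℤ)) 2),
        IsNewformOf W f → KuriharaUnitAt W p f)
    (hR : ∀ (W : WeierstrassCurve ℚ) [W.IsElliptic] [W.IsGloballyMinimal] (p : ℕ) [Fact p.Prime],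
      p = 3 → ClassX7 W p → ¬ W.HasCM → W.frobeniusTrace p = 0 → Surj W p →
      ¬ (KimKimSun2020TamAt W p ∧ ¬ p ∣ W.tamagawaProduct) →
      ¬ (∃ (ℓ : ℕ) (_ : Fact ℓ.Prime), ℓ ≠ p ∧ W.HasMultiplicativeReductionAtPrime ℓ ∧
          ¬ W.HasSplitMultiplicativeReductionAtPrime ℓ ∧ ¬ p ∣ padicValInt ℓ W.minimalDiscriminantInt) →
      ∃ ε : ℤˣ, KobayashiLowerDivisibility W p ε) :
    Summit.BirchSwinnertonDyer.BirchSwinnertonDyer.Theses.SignedLowerHalves.KobayashiLowerHalfLargeImage :=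
  kobayashiLowerHalfLargeImage_of_kim111_of_castellaSano_readings_OPEN hKK hCS hCSge h5 hLe
    (stub_three_of_kks_of_fw51_OPEN_of_kuriharaUnit_of_residue hKKS h3 hFW hU hR)

end Summit.BirchSwinnertonDyer.BirchSwinnertonDyer.Theorems.KuriharaRigidity
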